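import Literature.Probability.LatticeModels.KCObservableFlux
import Literature.Probability.LatticeModels.SpinorIncrements
import Literature.Probability.LatticeModels.SandwichGradientBound
import Literature.Probability.LatticeModels.IsingDisorderLaplacian
import HarnessLib

/-!
# The `L²` bound on the critical spin fermion in the bulk

Topic `Literature/Probability/LatticeModels`. Chelkak–Hongler–Izyurov 2015, §3.3–3.4 (Thm 3.12,
after Chelkak–Smirnov 2012, Thm 3.12): a family of spinor observables whose primitives `H_δ` are
uniformly bounded on compacts is precompact. The first quantitative step, in the tree's rendering of
Smirnov 2010, Lemma 5.3 (`FKObservableL2Bound.lean` for the FK observable), is the bulk `L²` bound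
`δ ∑_{Q} |F_δ|² ≤ C(Q)`; this file proves it for the signed critical Kadanoff–Ceva observable
`kcObs` (`IsingDisorderObservable.lean`) from

* the Kadanoff–Ceva primitive `(Hw, Hb)` (`IsingDisorderLaplacian.lean`: `Hb` subharmonic at the
  plaquettes where the cut ends, `Hw` superharmonic at the free sites, `Hw ≤ Hb` across corners),
* the sandwich gradient bound with a general height (`SandwichGradientBound.lean`),
* Remark 3.7 for spinor sections (`SpinorIncrements.lean`) and the identification of the fluxes of
  `kcObs` with `c_KC · X²` (`KCObservableFlux.lean`).

* `IsKCCuts.relAt_kcObs`: in the bulk (the site, its west and south neighbours free, its four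
  plaquettes carrying cuts of the system) `kcObs` is related at the four corners of a site.
* **`sum_norm_sq_kcObs_le`**: if the ball of radius `4m + 3` about the centre of a box of side `4m`
  is bulk (free sites off the background set with their four bonds in the domain graph, plaquettes
  of the cut system with odd cut parity and touching sides) and `|Hw|, |Hb| ≤ M` on the ball of
  radius `4m + 1`, then `∑_{ball m} (‖F(x,x+e₀)‖² + ‖F(x,x+e₁)‖²) ≤ 4 √2 c_KC M C m`.

Everything is proved; no named fact.

## References

* D. Chelkak, C. Hongler, K. Izyurov, Ann. of Math. 181 (2015): Prop. 3.6, Thm 3.12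
  [ChelkakHonglerIzyurovAnnals2015].
* S. Smirnov, Ann. of Math. 172 (2010): Lemma 5.3 [Smirnov2010].
-/

noncomputable section

namespace Literature.Probability.LatticeModels

open Finset Real SimpleGraph

variable (G₂ : SimpleGraph (Site 2)) [G₂.LocallyFinite]
variable {Λ : Finset (Site 2)} {η : SpinConfig (Site 2)} {B : Finset (Site 2)} {cut : Site 2 → Finset (Sym2 (Site 2))}
  {P : Set (Site 2)}

/-- The admissible step of a cut system across a bond whose lower/left endpoint is free, in the
`KCGaugeEquiv` form consumed by the s-holomorphicity statements. [cite: ChelkakHonglerIzyurov2021, §2.2] -/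
theorem IsKCCuts.step_gaugeEquiv (hc : IsKCCuts G₂ Λ cut P) {u : Site 2} (hu : u ∈ Λ) (k : Fin 4)
    (hk : faceAt u k ∈ P) (hk3 : faceAt u (k + 3) ∈ P) :
    cSrc (u, k) ∈ edgesTouching G₂ Λ ∧ KCGaugeEquiv G₂ Λ (symmDiff (cut (faceAt u k)) {cSrc (u, k)}) (cut (faceAt u (k + 3))) := by
  rcases hc.step u k hk hk3 with ⟨he, S, hS, hcut⟩ | ⟨hu', -⟩
  · exact ⟨he, S, hS, hcut⟩
  · exact absurd hu hu'

/-- **In the bulk the spin fermion is related at the four corners of a site**: `y`, `y - e₀`,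
`y - e₁` free and the four plaquettes at `y` in the cut system. [cite: ChelkakHonglerIzyurovAnnals2015, Prop. 2.4] -/
theorem IsKCCuts.relAt_kcObs (hc : IsKCCuts G₂ Λ cut P) (hG : ∀ v ∈ Λ, ∀ k : Fin 4, G₂.Adj v (v + cornerUnit k))
    (hle : G₂ ≤ zdGraph 2) {y : Site 2} (hy : y ∈ Λ) (hyW : y + cornerUnit 2 ∈ Λ) (hyS : y + cornerUnit 3 ∈ Λ)
    (hP : ∀ k : Fin 4, faceAt y k ∈ P) (k : Fin 4) : RelAt (kcObs G₂ Λ η B cut) (y, k) := by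
  obtain ⟨w0, wf0, wf3, -⟩ := westSite_facts y
  obtain ⟨s0, sf1, sf0, -⟩ := southSite_facts y
  fin_cases k
  · -- NE: step across the north bond of `y`, from `faceAt y 1` to `faceAt y 0`
    obtain ⟨he, hstep⟩ := hc.step_gaugeEquiv G₂ hy 1 (hP 1) (by rw [show (1 : Fin 4) + 3 = 0 from rfl]; exact hP 0)
    rw [show (1 : Fin 4) + 3 = 0 from rfl] at hstep
    exact relAt_kcObs_zero G₂ hG hle (hc.subset _ (hP 1)) he hstep
  · -- NW: step across the west bond of `y`, from `faceAt y 1` to `faceAt y 2`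
    have h1 : faceAt (y + cornerUnit 2) 0 ∈ P := by rw [wf0]; exact hP 1
    have h2 : faceAt (y + cornerUnit 2) (0 + 3) ∈ P := by rw [show (0 : Fin 4) + 3 = 3 from rfl, wf3]; exact hP 2
    obtain ⟨he, hstep⟩ := hc.step_gaugeEquiv G₂ hyW 0 h1 h2
    rw [show (0 : Fin 4) + 3 = 3 from rfl, wf0, wf3] at hstep
    simp only [cSrc] at he hstep
    exact relAt_kcObs_one G₂ hG hle (hc.subset _ (hP 1)) he hstep
  · -- SW: step across the south bond of `y`, from `faceAt y 2` to `faceAt y 3`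
    have h1 : faceAt (y + cornerUnit 3) 1 ∈ P := by rw [sf1]; exact hP 2
    have h2 : faceAt (y + cornerUnit 3) (1 + 3) ∈ P := by rw [show (1 : Fin 4) + 3 = 0 from rfl, sf0]; exact hP 3
    obtain ⟨he, hstep⟩ := hc.step_gaugeEquiv G₂ hyS 1 h1 h2
    rw [show (1 : Fin 4) + 3 = 0 from rfl, sf1, sf0] at hstep
    simp only [cSrc] at he hstep
    exact relAt_kcObs_two G₂ hG hle (hc.subset _ (hP 2)) he hstep
  · -- SE: step across the east bond of `y`, from `faceAt y 0` to `faceAt y 3`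
    obtain ⟨he, hstep⟩ := hc.step_gaugeEquiv G₂ hy 0 (hP 0) (by rw [show (0 : Fin 4) + 3 = 3 from rfl]; exact hP 3)
    rw [show (0 : Fin 4) + 3 = 3 from rfl] at hstep
    exact relAt_kcObs_three G₂ hG hle (hc.subset _ (hP 0)) he hstep

/-- **The bulk `L²` bound for the spin fermion** (Smirnov 2010 Lemma 5.3 / CHI 2015 Thm 3.12, first
step, lattice form). [cite: ChelkakHonglerIzyurovAnnals2015, Thm 3.12; Smirnov2010, Lemma 5.3] -/
theorem sum_norm_sq_kcObs_le {Hw Hb : Site 2 → ℝ} (h : IsKCPrimitive G₂ Λ criticalBetaTwo (.fixed η) B cut Hw Hb P)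
    (hc : IsKCCuts G₂ Λ cut P) (hG : ∀ v ∈ Λ, ∀ k : Fin 4, G₂.Adj v (v + cornerUnit k)) (hle : G₂ ≤ zdGraph 2)
    {a : Site 2} {m : ℕ} (hm : 4 ≤ m)
    (hΛ : ∀ x ∈ latticeBall (boxCentre a m) (2 * (2 * m) + 3), x ∈ Λ)
    (hB : ∀ x ∈ latticeBall (boxCentre a m) (2 * (2 * m) + 3), x ∉ B)
    (hbd : ∀ x ∈ latticeBall (boxCentre a m) (2 * (2 * m) + 3),
      edgeBoundary G₂ {x} = Finset.univ.image fun k : Fin 4 => cSrc (x, k))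
    (hP : ∀ x ∈ latticeBall (boxCentre a m) (2 * (2 * m) + 3), ∀ k : Fin 4, faceAt x k ∈ P)
    (hsides : ∀ f ∈ latticeBall (boxCentre a m) (2 * (2 * m) + 3), ∀ j : Fin 4,
      s(f + cornerOff j, f + cornerOff j + cornerUnit j) ∈ edgesTouching G₂ Λ)
    (hodd : ∀ f ∈ latticeBall (boxCentre a m) (2 * (2 * m) + 3),
      Odd #(Finset.univ.filter fun j : Fin 4 => s(f + cornerOff j, f + cornerOff j + cornerUnit j) ∈ cut f))
    {M : ℝ} (hM : 0 < M)
    (hHw : ∀ x ∈ latticeBall (boxCentre a m) (2 * (2 * m) + 1), |Hw x| ≤ M)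
    (hHb : ∀ x ∈ latticeBall (boxCentre a m) (2 * (2 * m) + 1), |Hb x| ≤ M) :
    ∑ x ∈ latticeBall (boxCentre a m) m,
      (‖kcObs G₂ Λ η B cut (cSrc (x, 0))‖ ^ 2 + ‖kcObs G₂ Λ η B cut (cSrc (x, 1))‖ ^ 2) ≤
      4 * Real.sqrt 2 * kcFluxConst * M * (energyGradConst * m) := by
  set c := boxCentre a m with hc0
  set F := kcObs G₂ Λ η B cut with hF
  have hsub : ∀ {R R' : ℤ}, R ≤ R' → ∀ x ∈ latticeBall c R, x ∈ latticeBall c R' :=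
    fun hRR' x hx => latticeBall_subset hRR' hx
  -- plaquettes of the big ball are in `P`, with their four neighbours
  have hPf : ∀ f ∈ latticeBall c (2 * (2 * m) + 2), f ∈ P ∧ ∀ j : Fin 4, f + cornerUnit (j + 3) ∈ P := by
    intro f hf
    refine ⟨?_, fun j => ?_⟩
    · have := hP f (hsub (by omega) f hf) 0; rwa [faceAt_zero_eq] at this
    · have hf' := add_cornerUnit_mem_latticeBall hf (j + 3)
      have := hP _ (hsub (by omega) _ hf') 0; rwa [faceAt_zero_eq] at this
  -- sub/superharmonicity
  have hsubHb : IsLatticeSubharmonicOn Hb (latticeBall c (2 * (2 * m)) : Set (Site 2)) := by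
    intro f hf
    have hf2 : f ∈ latticeBall c (2 * (2 * m) + 2) := hsub (by omega) f hf
    exact h.latticeLaplacian_black_nonneg hc (hPf f hf2).1 (hPf f hf2).2 (hsides f (hsub (by omega) f hf))
      (hodd f (hsub (by omega) f hf))
  have hsupHw : IsLatticeSuperharmonicOn Hw (latticeBall c (2 * (2 * m)) : Set (Site 2)) := by
    intro x hx
    have hx3 : x ∈ latticeBall c (2 * (2 * m) + 3) := hsub (by omega) x hx
    exact h.latticeLaplacian_white_nonpos hc (hΛ x hx3) (hB x hx3) (hP x hx3) (hbd x hx3)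
  have hboxball : ∀ x ∈ boxInterior a (4 * m), x ∈ latticeBall c (2 * (2 * m)) := fun x hx =>
    hsub (by omega) x ((mem_boxInterior_iff_mem_latticeBall (a := a) (m := m)).1 hx)
  -- `Hw ≤ Hb` across the corner `(x, NE)`
  have hws : ∀ x ∈ latticeBall c (2 * (2 * m) + 1), Hw x ≤ Hb x := by
    intro x hx
    have hx0 : faceAt x 0 ∈ P := hP x (hsub (by omega) x hx) 0
    have e := h (x, 0) (by simpa [faceSetCorners, cFace] using hx0)
    simp only [cFace, faceAt_zero_eq] at e
    have : 0 ≤ kcFlux G₂ Λ criticalBetaTwo (.fixed η) B cut (x, 0) := sq_nonneg _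
    linarith
  -- gradient bounds
  have hgradHb : ∑ x ∈ latticeBall c m, ∑ k : Fin 4, |Hb (x + cornerUnit k) - Hb x| ≤ 2 * M * (energyGradConst * m) :=
    sum_abs_sub_le_of_sandwich_bound (a := a) hm hM hsubHb (fun x hx => hsupHw x (hboxball x hx)) hHb hHw hws
  have hgradHw : ∑ x ∈ latticeBall c m, ∑ k : Fin 4, |Hw (x + cornerUnit k) - Hw x| ≤ 2 * M * (energyGradConst * m) :=
    sum_abs_sub_le_of_sandwich_bound' (a := a) hm hM (fun x hx => hsubHb x (hboxball x hx)) hsupHw hHb hHw hws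
  -- related corners at the sites of the ball of radius `m + 1`
  have hrel : ∀ y ∈ latticeBall c (m + 1), ∀ k : Fin 4, RelAt F (y, k) := by
    intro y hy k
    have hy3 : y ∈ latticeBall c (2 * (2 * m) + 3) := hsub (by omega) y hy
    have hyW : y + cornerUnit 2 ∈ latticeBall c (2 * (2 * m) + 3) := hsub (by omega) _ (add_cornerUnit_mem_latticeBall hy 2)
    have hyS : y + cornerUnit 3 ∈ latticeBall c (2 * (2 * m) + 3) := hsub (by omega) _ (add_cornerUnit_mem_latticeBall hy 3)
    exact hc.relAt_kcObs G₂ hG hle (hΛ y hy3) (hΛ _ hyW) (hΛ _ hyS) (hP y hy3) k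
  -- the flux increments are `c_KC ×` the increments of the primitive
  have hWk : ∀ x ∈ latticeBall c m, ∀ k : Fin 4,
      cornerFlux F (x, k) - cornerFlux F (x + cornerUnit k, k + 1) = kcFluxConst * (Hw (x + cornerUnit k) - Hw x) := by
    intro x hx k
    rw [hF, cornerFlux_kcObs, cornerFlux_kcObs, ← mul_sub, h.white_increment x k (hP x (hsub (by omega) x hx) k)]
  have hB0 : ∀ x ∈ latticeBall c m,
      cornerFlux F (x, (0 : Fin 4) + 3) - cornerFlux F (x, 0) = kcFluxConst * (Hb (x + cornerUnit 3) - Hb x) := by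
    intro x hx
    have hx2 : x ∈ latticeBall c (2 * (2 * m) + 2) := hsub (by omega) x hx
    have e := h.black_increment x 0 (hPf x hx2).1 ((hPf x hx2).2 0)
    simp only [show (0 : Fin 4) + 3 = 3 from rfl, show cornerOff 0 = 0 from rfl, add_zero] at e ⊢
    rw [hF, cornerFlux_kcObs, cornerFlux_kcObs, ← mul_sub, e]
  have hB1 : ∀ x ∈ latticeBall c m,
      cornerFlux F (x, (1 : Fin 4) + 3) - cornerFlux F (x, 1) = kcFluxConst * (Hb x - Hb (x + cornerUnit 2)) := by
    intro x hx
    -- the plaquette `f = x + e₂ = faceAt x 1`, side `j = 1` (corner `f + cornerOff 1 = x`), towards `f + e₀ = x`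
    have hf1 : x + cornerUnit 2 ∈ latticeBall c (2 * (2 * m) + 2) := hsub (by omega) _ (add_cornerUnit_mem_latticeBall hx 2)
    have e := h.black_increment (x + cornerUnit 2) 1 (hPf _ hf1).1 ((hPf _ hf1).2 1)
    have e1 : x + cornerUnit 2 + cornerOff 1 = x := by
      rw [add_assoc, show cornerUnit 2 + cornerOff 1 = 0 by decide, add_zero]
    have e2 : x + cornerUnit 2 + cornerUnit ((1 : Fin 4) + 3) = x := by
      rw [show (1 : Fin 4) + 3 = 0 from rfl, add_assoc, show cornerUnit 2 + cornerUnit 0 = 0 by decide, add_zero]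
    rw [e1, e2] at e
    simp only [show (1 : Fin 4) + 3 = 0 from rfl] at e ⊢
    rw [hF, cornerFlux_kcObs, cornerFlux_kcObs, ← mul_sub, e]
  -- the per-site bound
  have hκ := kcFluxConst_pos
  have hsite : ∀ x ∈ latticeBall c m,
      ‖F (cSrc (x, 0))‖ ^ 2 + ‖F (cSrc (x, 1))‖ ^ 2 ≤
        Real.sqrt 2 * kcFluxConst * ((∑ k : Fin 4, |Hw (x + cornerUnit k) - Hw x|) + ∑ k : Fin 4, |Hb (x + cornerUnit k) - Hb x|) := by
    intro x hx
    have hx1 : x ∈ latticeBall c (m + 1) := hsub (by omega) x hx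
    have h0 := norm_sq_le_increments_of_relAt F x 0 (hrel _ (add_cornerUnit_mem_latticeBall hx 0) _) (hrel x hx1 _)
    have h1 := norm_sq_le_increments_of_relAt F x 1 (hrel _ (add_cornerUnit_mem_latticeBall hx 1) _) (hrel x hx1 _)
    rw [hWk x hx 0, hB0 x hx] at h0
    rw [hWk x hx 1, hB1 x hx] at h1
    rw [abs_mul, abs_mul, abs_of_pos hκ] at h0 h1
    have hw4 : |Hw (x + cornerUnit 0) - Hw x| + |Hw (x + cornerUnit 1) - Hw x| ≤ ∑ k : Fin 4, |Hw (x + cornerUnit k) - Hw x| := by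
      rw [Fin.sum_univ_four]; linarith [abs_nonneg (Hw (x + cornerUnit 2) - Hw x), abs_nonneg (Hw (x + cornerUnit 3) - Hw x)]
    have hb4 : |Hb (x + cornerUnit 3) - Hb x| + |Hb x - Hb (x + cornerUnit 2)| ≤ ∑ k : Fin 4, |Hb (x + cornerUnit k) - Hb x| := by
      rw [Fin.sum_univ_four, abs_sub_comm (Hb x)]
      linarith [abs_nonneg (Hb (x + cornerUnit 0) - Hb x), abs_nonneg (Hb (x + cornerUnit 1) - Hb x)]
    have hs : 0 ≤ Real.sqrt 2 := Real.sqrt_nonneg 2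
    nlinarith [mul_nonneg hs hκ.le, hw4, hb4]
  -- sum up
  calc ∑ x ∈ latticeBall c m, (‖F (cSrc (x, 0))‖ ^ 2 + ‖F (cSrc (x, 1))‖ ^ 2)
      ≤ ∑ x ∈ latticeBall c m, Real.sqrt 2 * kcFluxConst *
          ((∑ k : Fin 4, |Hw (x + cornerUnit k) - Hw x|) + ∑ k : Fin 4, |Hb (x + cornerUnit k) - Hb x|) :=
        Finset.sum_le_sum hsite
    _ = Real.sqrt 2 * kcFluxConst * ((∑ x ∈ latticeBall c m, ∑ k : Fin 4, |Hw (x + cornerUnit k) - Hw x|) +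
          ∑ x ∈ latticeBall c m, ∑ k : Fin 4, |Hb (x + cornerUnit k) - Hb x|) := by
        rw [← Finset.mul_sum, Finset.sum_add_distrib]
    _ ≤ Real.sqrt 2 * kcFluxConst * (2 * M * (energyGradConst * m) + 2 * M * (energyGradConst * m)) := by
        have hs : 0 ≤ Real.sqrt 2 * kcFluxConst := mul_nonneg (Real.sqrt_nonneg 2) hκ.le
        exact mul_le_mul_of_nonneg_left (add_le_add hgradHw hgradHb) hs
    _ = 4 * Real.sqrt 2 * kcFluxConst * M * (energyGradConst * m) := by ring

end Literature.Probability.LatticeModels
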